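import Summits.ResolutionOfSingularities.ResolutionOfSingularities.Theorems.MarkedTransferCampaignW36SymbolicFGDoor
import Literature.AlgebraicGeometry.Hironaka2017.Lib.SpecOrders
import Mathlib.AlgebraicGeometry.Morphisms.FiniteType
import Mathlib.RingTheory.MvPolynomial.Basic
import HarnessLib

/-!
# [L1 W3.6 · CONE DATUM, Defs] res-type-009's «transversal square» device TYPED: on `𝔸^{d+1}_K = Spec K[w, x₁, …, x_d]`, for an ideal
# `𝔭₀ ⊆ K[x₁, …, x_d]` and `M ≥ 2`, the ideal exponent `E_𝔭₀ = ((w²) + (𝔭₀·𝒪)^M, 2)` whose singular locus is the CONE CUT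
# `C_𝔭₀ = V(𝔭₀) × {w = 0}` — the carrier on which a non-finitely-generated symbolic Rees algebra of `𝔭₀` would make `Ě` fail to exist

Cell `res-hironaka`, rung L, slot W3.6 lineage (seat res-L1-s36-pv-1, g1; split with res-L1-s36-pv-2 11:49:50Z: pv-2 = ring-level
transfer `TransversalSaturation` p528670 + «NON-FG ⇒ ¬SymbolicFGClass on the cone cut», pv-1 = this datum + the assembly through
`coreFocusExists_iff_symbolicFGClass`, p527634). GAP-LEDGER R12/12a, trigger (u) of res-adj-3 (complement inhabitation of `SymbolicFGClass`).
HOST item stmt-ResolutionOfSingularities-16155 via `--supports`. DEFINITIONS ONLY (the theorems — `Sing(E) = C`, `ord ≡ 2` on `C`, `Ê = E`,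
standardness, the row-001 ambient packaging facts and the assembly — are in `MarkedTransferCampaignW36ConeDatum.lean`).

HONEST FRAMING (D-0012/D-0089): an OURS datum over OUR typed carriers (row 001 `AmbientDatum` / `IdealExponent`, res-type-010's `SpecOrders.shf`);
the device is res-type-009's (ledger/evidence/R12/res-type-009-ObstructionCandidate-SannaiTanaka.md §3/§7), generalised from a prime to any
ideal `𝔭₀` and from `𝔸⁷`/`𝔸⁴` to `𝔸^{d+1}`; nothing printed in [Hironaka2017] is asserted (the manuscript never considers such data) and the
manuscript stays «under review». Whether `Inv` is constant along `C_𝔭₀` (res-type-009's joint (J2′)) is NOT decided by these files: it enters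
the assembly as the HYPOTHESIS `hΣ`, exactly as in res-type-010's specimen (A) (p488141). AI-produced; weaker than expert review.

* `ConeDatum.R K d = K[X₀, …, X_d]` (`w = X 0`, `x_i = X i.succ`), `ConeDatum.Z = Spec R = 𝔸^{d+1}`, `ConeDatum.hom`, `ConeDatum.ambient`
  (row-001 ambient datum; pattern of `SpecimenA.ambient`, p488141);
* `ConeDatum.coneIdeal 𝔭₀ = 𝔭₀·R + (w)` (extension along `rename Fin.succ`), `ConeDatum.C 𝔭₀ = V(coneIdeal) = supp (shf coneIdeal)`;
* `ConeDatum.J 𝔭₀ M = (w²) + (𝔭₀·R)^M`, `ConeDatum.E 𝔭₀ M = (shf J, 2)`.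
-/

noncomputable section

set_option linter.dupNamespace false -- mandated namespace of this single-conjunct summit

open _root_.AlgebraicGeometry _root_.TopologicalSpace _root_.CategoryTheory

namespace Summit.ResolutionOfSingularities.ResolutionOfSingularities.Theorems

open Literature.AlgebraicGeometry.Resolution
open Literature.AlgebraicGeometry.Hironaka2017
open Literature.AlgebraicGeometry.Hironaka2017.S02Preliminaries
open Literature.AlgebraicGeometry.Hironaka2017.SpecOrders
open MvPolynomial

universe u

namespace CampaignW36.ConeDatum

variable (K : Type u) [Field K] (d : ℕ)

/-- `R = K[X₀, X₁, …, X_d]`, the coordinate ring of `𝔸^{d+1}`; `w := X 0` is the transversal variable, `x_i := X i.succ`. Plumbing. [folklore] -/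
abbrev R : Type u := MvPolynomial (Fin (d + 1)) K

/-- `Z = Spec K[X₀, …, X_d] = 𝔸^{d+1}_K` (res-type-010's `SpecOrders.Zs`). Plumbing. [folklore] -/
abbrev Z : Scheme.{u} := Zs (R K d)

/-- The structure morphism `𝔸^{d+1}_K → Spec K`. Plumbing (pattern of `SpecimenA.hom`, p488141). [folklore] -/
def hom : Z K d ⟶ Spec (.of K) := Spec.map (CommRingCat.ofHom (algebraMap K (R K d)))

/-- **`𝔸^{d+1}_K` as a row-001 ambient datum** (characteristic `p`): irreducible, smooth over `Spec K`, quasi-compact (pattern of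
`SpecimenA.ambient`, p488141). OURS plumbing; replaces the role of nothing printed. [folklore] -/
def ambient (p : ℕ) [Fact p.Prime] [CharP K p] : AmbientDatum p K where
  Z := Z K d
  hom := hom K d
  irreducible := inferInstance
  smooth := by
    haveI : Algebra.Smooth K (R K d) := {}
    rw [hom, HasRingHomProperty.Spec_iff (P := @Smooth), CommRingCat.hom_ofHom, RingHom.smooth_algebraMap]
    infer_instance
  quasiCompact := inferInstance

/-- **The cone ideal `𝔭₀·R + (w) ⊆ K[w, x]`** of an ideal `𝔭₀ ⊆ K[x₁, …, x_d]` (extended along `x_i ↦ X i.succ`): its zero set is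
`V(𝔭₀) × {w = 0} ⊂ 𝔸^{d+1}`. OURS plumbing (res-type-009's device, §3 of the R12 evidence note). [folklore] -/
def coneIdeal (𝔭₀ : Ideal (MvPolynomial (Fin d) K)) : Ideal (R K d) :=
  𝔭₀.map (rename Fin.succ : MvPolynomial (Fin d) K →ₐ[K] R K d) ⊔ Ideal.span {X 0}

/-- **The cone cut `C_𝔭₀ = V(𝔭₀) × {w = 0}`** as a closed subset of `𝔸^{d+1}` (support of `shf coneIdeal`). OURS plumbing. [folklore] -/
def C (𝔭₀ : Ideal (MvPolynomial (Fin d) K)) : Closeds (Z K d) :=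
  (shf (R K d) (coneIdeal K d 𝔭₀)).support

/-- **The ideal `J = (w²) + (𝔭₀·R)^M`** — res-type-009's «transversal square» device. OURS plumbing. [folklore] -/
def J (𝔭₀ : Ideal (MvPolynomial (Fin d) K)) (M : ℕ) : Ideal (R K d) :=
  Ideal.span {(X 0 : R K d) ^ 2} ⊔ 𝔭₀.map (rename Fin.succ : MvPolynomial (Fin d) K →ₐ[K] R K d) ^ M

/-- **THE CONE DATUM `E_𝔭₀ = ((w²) + (𝔭₀·R)^M, 2)`** on `𝔸^{d+1}_K` (an ideal exponent of row 001 on `Spec K[w, x]`). For `M ≥ 2` its singular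
locus is the cone cut `C_𝔭₀` with order exactly `2` everywhere (`MarkedTransferCampaignW36ConeDatum`), so `Ê = E`; the core-focus question
for `E_𝔭₀` is then, by `coreFocusExists_iff_symbolicFGClass`, the finite generation of the symbolic algebra of `C_𝔭₀` — which a transversal
variable reduces to that of `𝔭₀` (res-L1-s36-pv-2, `TransversalSaturation`). OURS datum; replaces the role of nothing printed; NOT a statement
of the manuscript. [folklore] -/
def E (𝔭₀ : Ideal (MvPolynomial (Fin d) K)) (M : ℕ) : IdealExponent (Z K d) :=
  ⟨shf (R K d) (J K d 𝔭₀ M), 2⟩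

end CampaignW36.ConeDatum

end Summit.ResolutionOfSingularities.ResolutionOfSingularities.Theorems
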